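import Mathlib
import HarnessLib

/-!
# P3-PORT (D1): the abstract FIBRE / PROJECTION / BUDGET lemma of the circuit-distance bridge
# (cell `qec`, experiment CDX, seat qec-cdx-type-1; idea-1 CARD-2 `FibreSketch.lean` made provable)

Abstract setting, no circuit: a sector DETECTOR-ERROR MODEL (`DEM`) is a family of COLUMNS `ι`; column `i` has a
detector set `det i : Finset δ`, a residual `res i : V` (an `𝔽₂`-module) and a CLASS `cls i : Option γ` — `none` =
null column, `some g` = the extended-code generator `g` with support vector `gen g`; `stab : Submodule (ZMod 2) V` is
the stabiliser span.  `ClassHyp`: every in-scope column's residual is `≡ 0` resp. `≡ gen g (mod stab)`.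

Proved here (all `sorry`-free, generic):
* `proj_res_mem` — the residual of a set `F` of columns is, modulo `stab`, the word vector of its PROJECTION
  `proj F = {g : #{i ∈ F | cls i = g} odd}` (Strikis–Browne–Beverland arXiv:2603.05481 Prop. 3, made quantitative);
* `proj_card_add_null_le` — `|proj F| + #null columns ≤ |F|`;
* `tight_of_budget_le_one` — if `|F| ≤ |proj F| + 1` then every generator of `proj F` occurs exactly once, no other
  generator occurs, and `#nulls + |proj F| = |F|` (extras beyond the projection come in pairs).
The leaf link (`Leaf`, `not_realised_of_unsat`) is `PortFibreLeaf.lean`; the reduction and equivariance are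
`PortFibreReduction.lean`.  Nothing here mentions a circuit or asserts a value of `d_circ`.
-/

namespace Summit.Ventures.QEC.CircuitDistance.Fibre

open Finset

/-- A sector detector-error model with an extended-code labelling of its columns: detector set, residual, class
(`none` = null, `some g` = generator `g`), generator supports, stabiliser span. -/
structure DEM (ι δ γ V : Type*) [AddCommGroup V] [Module (ZMod 2) V] where
  /-- detector set of a column -/
  det : ι → Finset δ
  /-- residual data error of a column -/
  res : ι → V
  /-- class: `none` = null column, `some g` = generator `g` -/
  cls : ι → Option γ
  /-- support vector of a generator -/
  gen : γ → V
  /-- stabiliser span -/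
  stab : Submodule (ZMod 2) V

variable {ι δ γ V : Type*} [DecidableEq ι] [DecidableEq δ] [DecidableEq γ]
variable [AddCommGroup V] [Module (ZMod 2) V]

/-- `ClassHyp` on a scope: every in-scope column's residual is, modulo stabilisers, `0` (null) or its generator. -/
def ClassHyp (D : DEM ι δ γ V) (scope : Set ι) : Prop :=
  ∀ i ∈ scope, (D.cls i = none → D.res i ∈ D.stab) ∧ ∀ g, D.cls i = some g → D.res i - D.gen g ∈ D.stab

/-- A set of columns is SILENT iff every detector is hit an even number of times. -/
def Silent (D : DEM ι δ γ V) (F : Finset ι) : Prop :=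
  ∀ d, Even ((F.filter fun i => d ∈ D.det i).card)

/-- Residual of a set of columns (sum over `𝔽₂`). -/
def resOf (D : DEM ι δ γ V) (F : Finset ι) : V := ∑ i ∈ F, D.res i

/-- Multiplicity of the class `g` in `F`. -/
def mult (D : DEM ι δ γ V) (F : Finset ι) (g : γ) : ℕ := (F.filter fun i => D.cls i = some g).card

/-- PROJECTION of a set of columns to an extended-code word: the generators of odd multiplicity (computed inside the
image of `F`, so no `Fintype γ` is needed). -/
def proj (D : DEM ι δ γ V) (F : Finset ι) : Finset γ :=
  (F.image D.cls).eraseNone.filter fun g => Odd (mult D F g)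

/-- Number of null columns in `F`. -/
def nullCount (D : DEM ι δ γ V) (F : Finset ι) : ℕ := (F.filter fun i => D.cls i = none).card

/-- The word vector (sum of generator supports) of a set of generators. -/
def wordVec (D : DEM ι δ γ V) (x : Finset γ) : V := ∑ g ∈ x, D.gen g

omit [DecidableEq ι] [DecidableEq δ] [DecidableEq γ] in
/-- In a `ZMod 2`-module `v + v = 0`. -/
theorem two_smul_eq_zero (v : V) : v + v = 0 := by
  have h : (2 : ZMod 2) • v = v + v := two_smul (ZMod 2) v
  rw [← h]
  have : (2 : ZMod 2) = 0 := by decide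
  rw [this, zero_smul]

omit [DecidableEq ι] [DecidableEq δ] in
/-- A class has positive multiplicity iff it occurs. -/
theorem one_le_mult_iff (D : DEM ι δ γ V) (F : Finset ι) (g : γ) :
    1 ≤ mult D F g ↔ some g ∈ F.image D.cls := by
  unfold mult
  rw [Nat.one_le_iff_ne_zero, Ne, Finset.card_eq_zero, Finset.filter_eq_empty_iff, Finset.mem_image]
  push Not
  exact Iff.rfl

omit [DecidableEq ι] [DecidableEq δ] in
/-- Membership in the projection = odd multiplicity. -/
theorem mem_proj (D : DEM ι δ γ V) (F : Finset ι) (g : γ) : g ∈ proj D F ↔ Odd (mult D F g) := by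
  unfold proj
  rw [Finset.mem_filter, Finset.mem_eraseNone]
  constructor
  · exact fun h => h.2
  · intro h
    refine ⟨?_, h⟩
    rw [← one_le_mult_iff]
    exact h.pos

omit [DecidableEq ι] [DecidableEq δ] in
/-- The projection lies inside the classes met by `F`. -/
theorem proj_subset (D : DEM ι δ γ V) (F : Finset ι) : proj D F ⊆ (F.image D.cls).eraseNone := by
  unfold proj; exact Finset.filter_subset _ _

omit [DecidableEq δ] in
/-- Multiplicities of an insertion. -/
theorem mult_insert (D : DEM ι δ γ V) {F : Finset ι} {a : ι} (ha : a ∉ F) (g : γ) :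
    mult D (insert a F) g = mult D F g + if D.cls a = some g then 1 else 0 := by
  unfold mult
  rw [Finset.filter_insert]
  split_ifs with h
  · rw [Finset.card_insert_of_notMem]
    intro h'; exact ha (Finset.mem_filter.1 h').1
  · simp

omit [DecidableEq δ] in
/-- Inserting a null column does not change the projection. -/
theorem proj_insert_none (D : DEM ι δ γ V) {F : Finset ι} {a : ι} (ha : a ∉ F) (h : D.cls a = none) :
    proj D (insert a F) = proj D F := by
  ext g
  rw [mem_proj, mem_proj, mult_insert D ha, h]
  simp

omit [DecidableEq δ] in
/-- Inserting a column of class `g₀` toggles `g₀` in the projection. -/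
theorem proj_insert_some (D : DEM ι δ γ V) {F : Finset ι} {a : ι} (ha : a ∉ F) {g₀ : γ} (h : D.cls a = some g₀) :
    proj D (insert a F) = symmDiff (proj D F) {g₀} := by
  ext g
  rw [mem_proj, mult_insert D ha, h, Finset.mem_symmDiff, mem_proj, Finset.mem_singleton]
  by_cases hg : g = g₀
  · subst hg
    simp only [if_true]
    rw [Nat.odd_add_one]
    tauto
  · have : ¬ some g₀ = some g := fun e => hg (Option.some_injective _ e).symm
    simp only [this, if_false, add_zero]
    tauto

omit [DecidableEq ι] [DecidableEq δ] in
/-- Toggling a generator changes the word vector by its support (characteristic 2). -/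
theorem wordVec_symmDiff_singleton (D : DEM ι δ γ V) (x : Finset γ) (g : γ) :
    wordVec D (symmDiff x {g}) = wordVec D x + D.gen g := by
  unfold wordVec
  by_cases hg : g ∈ x
  · have : symmDiff x {g} = x.erase g := by
      ext a; simp [Finset.mem_symmDiff, Finset.mem_erase]
      constructor
      · rintro (⟨h1, h2⟩ | ⟨h1, h2⟩)
        · exact ⟨h2, h1⟩
        · exact absurd (h1 ▸ hg) h2
      · rintro ⟨h1, h2⟩; exact Or.inl ⟨h2, h1⟩
    rw [this, ← Finset.sum_erase_add x _ hg]
    rw [add_assoc, two_smul_eq_zero, add_zero]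
  · have : symmDiff x {g} = insert g x := by
      ext a; simp [Finset.mem_symmDiff, Finset.mem_insert]
      constructor
      · rintro (⟨h1, _⟩ | ⟨h1, _⟩)
        · exact Or.inr h1
        · exact Or.inl h1
      · rintro (h1 | h1)
        · exact Or.inr ⟨h1, h1 ▸ hg⟩
        · exact Or.inl ⟨h1, fun e => hg (e ▸ h1)⟩
    rw [this, Finset.sum_insert hg, add_comm]

omit [DecidableEq δ] in
/-- **PROJECTION LEMMA** (SBB26 Prop. 3's map, quantitative): the residual of `F` is the word vector of `proj F`
modulo stabilisers. -/
theorem proj_res_mem (D : DEM ι δ γ V) {scope : Set ι} (hD : ClassHyp D scope) (F : Finset ι)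
    (hF : ∀ i ∈ F, i ∈ scope) : resOf D F - wordVec D (proj D F) ∈ D.stab := by
  induction F using Finset.induction_on with
  | empty =>
    have : proj D (∅ : Finset ι) = ∅ := by unfold proj; simp
    rw [this]; unfold resOf wordVec; simp
  | insert a F ha ih =>
    have hF' : ∀ i ∈ F, i ∈ scope := fun i hi => hF i (Finset.mem_insert_of_mem hi)
    have haS : a ∈ scope := hF a (Finset.mem_insert_self a F)
    have ih' := ih hF'
    have hres : resOf D (insert a F) = D.res a + resOf D F := by
      unfold resOf; rw [Finset.sum_insert ha]
    rcases hcls : D.cls a with _ | g₀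
    · rw [proj_insert_none D ha hcls, hres]
      have h1 := (hD a haS).1 hcls
      have : D.res a + resOf D F - wordVec D (proj D F) = D.res a + (resOf D F - wordVec D (proj D F)) := by abel
      rw [this]
      exact D.stab.add_mem h1 ih'
    · rw [proj_insert_some D ha hcls, wordVec_symmDiff_singleton, hres]
      have h1 := (hD a haS).2 g₀ hcls
      have : D.res a + resOf D F - (wordVec D (proj D F) + D.gen g₀) =
          (D.res a - D.gen g₀) + (resOf D F - wordVec D (proj D F)) := by abel
      rw [this]
      exact D.stab.add_mem h1 ih'

omit [DecidableEq ι] [DecidableEq δ] in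
/-- `F` splits into its null columns and the class fibres over the generators it meets. -/
theorem card_eq_nullCount_add_sum (D : DEM ι δ γ V) (F : Finset ι) :
    F.card = nullCount D F + ∑ g ∈ (F.image D.cls).eraseNone, mult D F g := by
  classical
  have h := Finset.card_eq_sum_card_fiberwise (s := F) (t := F.image D.cls) (f := D.cls)
    (fun x hx => Finset.mem_image_of_mem _ hx)
  have hre : ∑ g ∈ (F.image D.cls).eraseNone, mult D F g =
      ∑ o ∈ (F.image D.cls).erase none, (F.filter fun x => D.cls x = o).card := by
    rw [← Finset.map_some_eraseNone, Finset.sum_map]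
    rfl
  rw [hre, h]
  unfold nullCount
  by_cases hn : none ∈ F.image D.cls
  · rw [← Finset.add_sum_erase _ _ hn]
  · rw [Finset.erase_eq_of_notMem hn]
    have : (F.filter fun i => D.cls i = none).card = 0 := by
      rw [Finset.card_eq_zero, Finset.filter_eq_empty_iff]
      intro x hx hxn
      exact hn (hxn ▸ Finset.mem_image_of_mem _ hx)
    rw [this, zero_add]

omit [DecidableEq ι] [DecidableEq δ] in
/-- Weight does not increase under projection, with the null columns to spare: `|proj F| + #nulls ≤ |F|`. -/
theorem proj_card_add_null_le (D : DEM ι δ γ V) (F : Finset ι) :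
    (proj D F).card + nullCount D F ≤ F.card := by
  rw [card_eq_nullCount_add_sum D F, add_comm]
  apply Nat.add_le_add_left
  calc (proj D F).card = ∑ g ∈ proj D F, 1 := by simp
    _ ≤ ∑ g ∈ proj D F, mult D F g := by
        apply Finset.sum_le_sum
        intro g hg
        exact ((mem_proj D F g).1 hg).pos
    _ ≤ ∑ g ∈ (F.image D.cls).eraseNone, mult D F g :=
        Finset.sum_le_sum_of_subset_of_nonneg (proj_subset D F) (fun _ _ _ => Nat.zero_le _)

omit [DecidableEq ι] [DecidableEq δ] in
/-- **BUDGET `≤ 1`.** If `|F| ≤ |proj F| + 1` then every generator of `proj F` occurs exactly once, no other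
generator occurs, and `#nulls + |proj F| = |F|` (so at most one null column). -/
theorem tight_of_budget_le_one (D : DEM ι δ γ V) (F : Finset ι) (h : F.card ≤ (proj D F).card + 1) :
    (∀ g ∈ proj D F, mult D F g = 1) ∧ (∀ g ∉ proj D F, mult D F g = 0) ∧
      nullCount D F + (proj D F).card = F.card := by
  have hcard := card_eq_nullCount_add_sum D F
  set I := (F.image D.cls).eraseNone with hI
  have hsub : proj D F ⊆ I := proj_subset D F
  -- the sum over I dominates |proj| + 2·(any excess)
  have hsum_split : ∑ g ∈ I, mult D F g = (∑ g ∈ proj D F, mult D F g) + ∑ g ∈ I \ proj D F, mult D F g := by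
    rw [← Finset.sum_sdiff hsub, add_comm]
  have hge1 : ∀ g ∈ proj D F, 1 ≤ mult D F g := fun g hg => ((mem_proj D F g).1 hg).pos
  have hprojle : (proj D F).card ≤ ∑ g ∈ proj D F, mult D F g := by
    calc (proj D F).card = ∑ g ∈ proj D F, 1 := by simp
      _ ≤ _ := Finset.sum_le_sum hge1
  -- (1) every g ∈ proj has multiplicity exactly 1
  have h1 : ∀ g ∈ proj D F, mult D F g = 1 := by
    intro g hg
    by_contra hne
    have hodd := (mem_proj D F g).1 hg
    have hge3 : 3 ≤ mult D F g := by
      rcases hodd with ⟨k, hk⟩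
      omega
    have : (proj D F).card + 2 ≤ ∑ g ∈ proj D F, mult D F g := by
      rw [← Finset.add_sum_erase _ _ hg]
      have : (proj D F).card = ((proj D F).erase g).card + 1 := by
        rw [Finset.card_erase_of_mem hg]; have := Finset.card_pos.2 ⟨g, hg⟩; omega
      rw [this]
      have : ((proj D F).erase g).card ≤ ∑ x ∈ (proj D F).erase g, mult D F x := by
        calc ((proj D F).erase g).card = ∑ x ∈ (proj D F).erase g, 1 := by simp
          _ ≤ _ := Finset.sum_le_sum fun x hx => hge1 x (Finset.mem_of_mem_erase hx)
      omega
    omega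
  -- (2) no generator outside proj occurs
  have h2 : ∀ g ∉ proj D F, mult D F g = 0 := by
    intro g hg
    by_contra hne
    have hpos : 1 ≤ mult D F g := Nat.one_le_iff_ne_zero.2 hne
    have hgI : g ∈ I := by rw [hI, Finset.mem_eraseNone, ← one_le_mult_iff]; exact hpos
    have heven : Even (mult D F g) := by
      rcases Nat.even_or_odd (mult D F g) with he | ho
      · exact he
      · exact absurd ((mem_proj D F g).2 ho) hg
    have hge2 : 2 ≤ mult D F g := by rcases heven with ⟨k, hk⟩; omega
    have hmem : g ∈ I \ proj D F := Finset.mem_sdiff.2 ⟨hgI, hg⟩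
    have : 2 ≤ ∑ x ∈ I \ proj D F, mult D F x := by
      rw [← Finset.add_sum_erase _ _ hmem]
      omega
    omega
  refine ⟨h1, h2, ?_⟩
  have hs1 : ∑ g ∈ proj D F, mult D F g = (proj D F).card := by
    rw [Finset.card_eq_sum_ones]; exact Finset.sum_congr rfl h1
  have hs2 : ∑ g ∈ I \ proj D F, mult D F g = 0 := by
    apply Finset.sum_eq_zero
    intro g hg
    exact h2 g (Finset.mem_sdiff.1 hg).2
  omega

end Summit.Ventures.QEC.CircuitDistance.Fibre
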